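import Summits.BirchSwinnertonDyer.BirchSwinnertonDyer.Theorems.ManinLocalTwoThreeCDivisionGamma1Core
import Literature.NumberTheory.ComplexMultiplication.EllipticUnits.KatoUnitRepIndependence
import HarnessLib

/-!
# A `Γ₁(N)`-presentation of `℘_{Λ₁}(ℰ_f)` and a period pair for the Stevens lattice `Λ₁(f)`
(route `ManinLocalTwoThree`, cruxes C2 stmt-BirchSwinnertonDyer-22967 / C3 stmt-BirchSwinnertonDyer-22968; cell bsd-f2-manin, prover p3 gen 21;
CES-discharge programme, stage 1 steps (A1)–(A2))

For a nonzero `f ∈ S₂(Γ₀(N))` and a period pair `L` whose stabiliser `{γ ∈ Γ₀(N) : {∞, γ∞}_f ∈ Λ(L)}` contains `Γ₁(N)` and which lies in a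
period pair `L′ ⊇ Λ₀(f)` (for the Stevens lattice `Λ₁(f) = periodLatticeGamma1 f`: `L′ = φ(N)⁻¹Λ₁ ⊇ Λ₀(f)` by `φ(N)Λ₀ ⊆ Λ₁`), the
`Γ₁(N)`-invariant meromorphic function `x₁ = ℘_L(ℰ_f)` (`ℰ_f = 2πi∫_{i∞} f`) is a QUOTIENT OF CUSP FORMS ON `Γ₁(N)`:

* `exists_exponent_isZeroAtImInfty` — growth at every cusp (the (N6) template `CDivGrowth.cDivGrowth_uniform`, datum-free and with conclusion
  `IsZeroAtImInfty`): for a finite-index `Γ ≤ SL(2, ℤ)` an exponent `a` such that every `Γ`-invariant `F = ℘_L(ℰ_f)·(12·B·Δ^a)`,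
  `B ∈ S_w(Γ₀(N))`, vanishes at every cusp;
* `exists_gamma1_presentation` — **`∃ k ≥ 1, F₁, G₁ ∈ S_k(Γ₁(N))`, `G₁ ≠ 0`, `℘_L(ℰ_f)·G₁ = F₁` off the poles** (X₀-presentation of
  `℘_{L′}(ℰ_f)` by `exists_isXPresentation`; the datum-free witness `CDivision.exists_cDivisionWitness_of_presentation` — pole killing,
  invariant extension, Manin's lemma — at the sublattice `L`; packaging as `CuspForm (Gamma1 N)`);
* `exists_periodPair_periodLatticeGamma1` — a period pair `L₁` with `Λ(L₁) = Λ₁(f)` (`PeriodPair.exists_lattice_eq_of_le` over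
  `φ(N)Λ₀ ⊆ Λ₁ ⊆ Λ₀`), given one for `Λ₀(f)`;
* `exists_gamma1_presentation_periodLatticeGamma1` — the presentation for `Λ₁(f)` itself, in the shape of hypothesis `hpres` of the
  sibling `StevensCurve.ratCast_g₂_g₃_of_gamma1_presentation`.

HONEST FRAMING: analytic; no named fact used or introduced; CES / C2 / C3 / Manin's conjecture / BSD are NOT proved here.
[cite: ShimuraIATAF1971, §2.4 and Thm. 7.14] [cite: Stevens1989, §2] [cite: Manin1972, Prop. 1.4] [cite: LingOesterle1991, Thm. 1]
-/

set_option autoImplicit false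
-- lint-debt: the directory name repeats the summit name (sibling precedent `ManinLocalTwoThreeCDivisionGamma1Core.lean`)
set_option linter.dupNamespace false

noncomputable section

open Complex Filter Topology Set Function
open UpperHalfPlane hiding I
open scoped Real Topology Manifold MatrixGroups PeriodPair ModularForm
open ModularForm CongruenceSubgroup
open Literature.NumberTheory.EllipticCurves Literature.NumberTheory.EllipticCurves.ModularForms

namespace Summit.BirchSwinnertonDyer.BirchSwinnertonDyer.Theorems.ManinLocalTwoThree.StevensCurve

variable {N : ℕ} [NeZero N]

/-! ### (N6) growth, datum-free, with vanishing at the cusps -/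

/-- **Growth at every cusp, uniform exponent.**  For `f ≠ 0`, a period pair `L` and a finite-index `Γ ≤ SL(2, ℤ)` there is `a ≥ 2` such
that for every weight `w`, every `B ∈ S_w(Γ₀(N))` and every `Γ`-invariant `F` of weight `w + 12a` equal to `℘_L(ℰ_f)·(12·B·Δ^a)` off the poles,
`F ∣[w+12a] g → 0` at `i∞` for every `g ∈ SL(2, ℤ)`: along coset representatives `R` of `Γ`, `a = 2 + Σ_{r ∈ R}(2m_r + 1)` with `m_r` the order at
`q_N = 0` of `V_{f∣r}`, `ℰ_f(r·τ) = C_r + V_{f∣r}(τ)`, `℘_L(C_r + V_{f∣r})·Δ^a → 0` (`IsCuspFunction.tendsto_weierstrassP_mul_pow_atImInfty`) and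
`B ∣[w] r` bounded (the (N6) template `CDivGrowth.cDivGrowth_uniform`, verbatim up to the datum). [cite: ShimuraIATAF1971, §2.4, Thm. 7.14] -/
theorem exists_exponent_isZeroAtImInfty (f : CuspForm (Gamma0 N) 2) (hf : f ≠ 0) (L : PeriodPair)
    (Γ : Subgroup SL(2, ℤ)) [hfi : Γ.FiniteIndex] :
    ∃ a : ℕ, 2 ≤ a ∧ ∀ (w : ℤ) (B : CuspForm (Gamma0 N) w) (F : ℍ → ℂ), (∀ γ ∈ Γ, F ∣[w + 12 * (a : ℤ)] γ = F) →
      (∀ τ : ℍ, eichlerIntegral f τ ∉ L.lattice →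
        F τ = ℘[L] (eichlerIntegral f τ) * ((12 : ℂ) * B τ * ModularForm.discriminant τ ^ a)) →
      ∀ g : SL(2, ℤ), IsZeroAtImInfty (F ∣[w + 12 * (a : ℤ)] g) := by
  classical
  obtain ⟨R, hR⟩ := exists_finset_mul_cover Γ
  set m : SL(2, ℤ) → ℕ := fun r ↦ analyticOrderNatAt (cuspFunction N (verticalIntegral (⇑f ∣[(2 : ℤ)] r))) 0 with hm
  set a : ℕ := 2 + ∑ r ∈ R, (2 * m r + 1) with ha
  have haR : ∀ r ∈ R, 2 * m r + 1 ≤ a := fun r hr ↦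
    (Finset.single_le_sum (f := fun r ↦ 2 * m r + 1) (fun _ _ ↦ Nat.zero_le _) hr).trans (Nat.le_add_left _ _)
  refine ⟨a, Nat.le_add_right _ _, fun w B F hFinv hFeq g ↦ ?_⟩
  obtain ⟨γ, hγ, r, hr, hg⟩ := hR g
  -- `F ∣ g = F ∣ r`
  have hslash : F ∣[w + 12 * (a : ℤ)] g = F ∣[w + 12 * (a : ℤ)] r := by
    rw [hg, SlashAction.slash_mul, hFinv γ hγ]
  -- the cusp `r·i∞`
  obtain ⟨C, hC⟩ := exists_eichlerIntegral_smul_eq f r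
  obtain ⟨T, hT⟩ := exists_forall_eichlerIntegral_smul_notMem f hf L r
  have hlim := (isCuspFunction_verticalIntegral_slash f r).tendsto_weierstrassP_mul_pow_atImInfty
    (verticalIntegral_slash_ne_zero f hf r) isCuspFunction_discriminant L C (haR r hr)
  have hBz : IsZeroAtImInfty (⇑B ∣[w] r) := CuspFormClass.zero_at_infty_slash B r
  have hprod : Tendsto (fun τ : ℍ ↦ ℘[L] (C + verticalIntegral (⇑f ∣[(2 : ℤ)] r) τ) * ModularForm.discriminant τ ^ a *
      ((12 : ℂ) * (⇑B ∣[w] r) τ)) atImInfty (𝓝 0) := by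
    have h12 : Tendsto (fun τ : ℍ ↦ (12 : ℂ) * (⇑B ∣[w] r) τ) atImInfty (𝓝 0) := by
      simpa using (hBz : Tendsto _ _ _).const_mul (12 : ℂ)
    simpa using hlim.mul h12
  have hmem : {τ : ℍ | T ≤ τ.im} ∈ atImInfty := (atImInfty_mem _).mpr ⟨T, fun _ h ↦ h⟩
  rw [hslash]
  refine (hprod.congr' ?_ : Tendsto (F ∣[w + 12 * (a : ℤ)] r) atImInfty (𝓝 0))
  filter_upwards [hmem] with τ hτ
  have hd : denom (r : SL(2, ℤ)) τ ≠ 0 := denom_ne_zero _ τ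
  -- the value of `F ∣ r` high in the cusp (verbatim the (N6) computation)
  have hval : (F ∣[w + 12 * (a : ℤ)] r) τ =
      ℘[L] (C + verticalIntegral (⇑f ∣[(2 : ℤ)] r) τ) * ModularForm.discriminant τ ^ a *
        ((12 : ℂ) * (⇑B ∣[w] r) τ) := by
    rw [ModularForm.SL_slash_apply, ModularForm.SL_slash_apply, hFeq (r • τ) (hT τ hτ), hC τ, discriminant_apply_smul r τ,
      mul_pow, ← zpow_natCast, ← zpow_mul, neg_add, zpow_add₀ hd, zpow_neg, zpow_neg]
    field_simp
  exact hval.symm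

/-! ### The `Γ₁(N)`-presentation -/

omit [NeZero N] in
/-- `12·G·Δ^a` is slash-invariant of weight `K = k + 12a` under `Γ₀(N)` (function-level form of
`CDivision.twelve_mul_mul_discriminant_pow_apply_smul`). [folklore] -/
theorem twelve_mul_mul_discriminant_pow_slash {k : ℤ} (G : CuspForm (Gamma0 N) k) (a K : ℕ) (hK : (K : ℤ) = k + 12 * a)
    (γ : SL(2, ℤ)) (hγ : γ ∈ Gamma0 N) :
    (fun τ : ℍ ↦ 12 * G τ * ModularForm.discriminant τ ^ a) ∣[(K : ℤ)] γ =
      fun τ : ℍ ↦ 12 * G τ * ModularForm.discriminant τ ^ a := by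
  funext τ
  have hd : denom γ τ ≠ 0 := denom_ne_zero γ τ
  rw [ModularForm.SL_slash_apply, CDivision.twelve_mul_mul_discriminant_pow_apply_smul G a K hK γ hγ τ, zpow_neg, zpow_natCast]
  field_simp

omit [NeZero N] in
/-- `(12·G·Δ^a) ∣[K] g = 12·(G ∣[k] g)·Δ^a` for every `g ∈ SL(2, ℤ)`. [folklore] -/
theorem twelve_mul_mul_discriminant_pow_slash_apply {k : ℤ} (G : CuspForm (Gamma0 N) k) (a K : ℕ) (hK : (K : ℤ) = k + 12 * a)
    (g : SL(2, ℤ)) (τ : ℍ) :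
    ((fun τ : ℍ ↦ 12 * G τ * ModularForm.discriminant τ ^ a) ∣[(K : ℤ)] g) τ =
      12 * (⇑G ∣[k] g) τ * ModularForm.discriminant τ ^ a := by
  have hd : denom g τ ≠ 0 := denom_ne_zero g τ
  rw [ModularForm.SL_slash_apply, ModularForm.SL_slash_apply, discriminant_apply_smul g τ, mul_pow, ← zpow_natCast (denom g τ ^ (12 : ℤ)) a,
    ← zpow_mul, hK, neg_add, zpow_add₀ hd, zpow_neg, zpow_neg]
  field_simp

/-- **A `Γ₁(N)`-presentation of `℘_L(ℰ_f)`.**  Let `f ∈ S₂(Γ₀(N))`, `f ≠ 0`, and let `L ⊆ L′` be period pairs with `Λ₀(f) ⊆ Λ(L′)` and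
`{∞, γ∞}_f ∈ Λ(L)` for every `γ ∈ Γ₁(N)`.  Then `℘_L(ℰ_f)·G₁ = F₁` off the poles for some `F₁, G₁ ∈ S_k(Γ₁(N))`, `k ≥ 1`, `G₁ ≠ 0`:
`G₁ = 12·G·Δ^a` for an `X₀`-presentation `(Fx, G)` of `℘_{L′}(ℰ_f)` (`exists_isXPresentation`) and `F₁` the holomorphic invariant extension of
`12·℘_L(ℰ_f)·G·Δ^a` (`CDivision.exists_cDivisionWitness_of_presentation`), a cusp form by `exists_exponent_isZeroAtImInfty`.
[cite: ShimuraIATAF1971, §2.4 and Thm. 7.14] [cite: Manin1972, Prop. 1.4] -/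
theorem exists_gamma1_presentation (f : CuspForm (Gamma0 N) 2) (hf : f ≠ 0) (L L' : PeriodPair)
    (hLL' : ∀ z ∈ L.lattice, z ∈ L'.lattice) (hΛ' : ∀ x ∈ periodLattice f, x ∈ L'.lattice)
    (hΓ₁ : ∀ γ : Gamma1 N, cuspSymbol f ⟨(γ : SL(2, ℤ)), Gamma1_in_Gamma0 N γ.2⟩ ∈ L.lattice) :
    ∃ (k : ℤ) (F G : CuspForm (Gamma1 N) k), 1 ≤ k ∧ G ≠ 0 ∧
      ∀ τ : ℍ, eichlerIntegral f τ ∉ L.lattice → ℘[L] (eichlerIntegral f τ) * G τ = F τ := by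
  obtain ⟨a, ha2, hgrowth⟩ := exists_exponent_isZeroAtImInfty f hf L (Gamma1 N)
  obtain ⟨k, Fx, G, hk, hX⟩ := exists_isXPresentation f hf L' hΛ'
  have hk0 : 0 ≤ k := by omega
  obtain ⟨F, hFmd, hFeq, hiff⟩ := CDivision.exists_cDivisionWitness_of_presentation f hf hLL' hk0 hX a
  set K : ℕ := k.toNat + 12 * a with hKdef
  have hK : (K : ℤ) = k + 12 * a := by
    rw [hKdef]; push_cast; rw [Int.toNat_of_nonneg hk0]
  -- invariance of `F` under `Γ₁(N)` and vanishing at the cusps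
  have hFslash : ∀ γ ∈ Gamma1 N, F ∣[(K : ℤ)] γ = F := fun γ hγ ↦ by
    rw [hK]
    exact (hiff ⟨γ, Gamma1_in_Gamma0 N hγ⟩).mp (hΓ₁ ⟨γ, hγ⟩)
  have hFzero : ∀ g : SL(2, ℤ), IsZeroAtImInfty (F ∣[(K : ℤ)] g) := by
    intro g
    rw [hK]
    refine hgrowth k G F (fun γ hγ ↦ ?_) (fun τ hτ ↦ ?_) g
    · exact (hiff ⟨γ, Gamma1_in_Gamma0 N hγ⟩).mp (hΓ₁ ⟨γ, hγ⟩)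
    · rw [← hFeq τ hτ]; ring
  -- the pole-killer `12·G·Δ^a`
  set Gt : ℍ → ℂ := fun τ ↦ 12 * G τ * ModularForm.discriminant τ ^ a with hGt
  have hGan : AnalyticOnNhd ℂ (Gt ∘ ofComplex) {z : ℂ | 0 < z.im} := CDivision.analyticOnNhd_twelve_mul_mul_discriminant_pow G a
  have hGtmd : MDifferentiable 𝓘(ℂ) 𝓘(ℂ) Gt := UpperHalfPlane.mdifferentiable_iff.mpr hGan.differentiableOn
  have hGslash : ∀ γ ∈ Gamma1 N, Gt ∣[(K : ℤ)] γ = Gt := fun γ hγ ↦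
    twelve_mul_mul_discriminant_pow_slash G a K hK γ (Gamma1_in_Gamma0 N hγ)
  have hGzero : ∀ g : SL(2, ℤ), IsZeroAtImInfty (Gt ∣[(K : ℤ)] g) := by
    intro g
    have h1 : IsZeroAtImInfty (⇑G ∣[k] g) := CuspFormClass.zero_at_infty_slash G g
    have hΔ : Tendsto (fun τ : ℍ ↦ ModularForm.discriminant τ ^ a) atImInfty (𝓝 0) := by
      have := (ModularForm.discriminant_isZeroAtImInfty : Tendsto _ _ _).pow a
      rwa [zero_pow (by omega : a ≠ 0)] at this
    have h2 : Tendsto (fun τ : ℍ ↦ 12 * (⇑G ∣[k] g) τ * ModularForm.discriminant τ ^ a) atImInfty (𝓝 0) := by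
      simpa using ((h1 : Tendsto _ _ _).const_mul (12 : ℂ)).mul hΔ
    refine (h2.congr' (Eventually.of_forall fun τ ↦ ?_) : Tendsto (Gt ∣[(K : ℤ)] g) atImInfty (𝓝 0))
    exact (twelve_mul_mul_discriminant_pow_slash_apply G a K hK g τ).symm
  -- packaging as cusp forms on `Γ₁(N)`
  let F₁ : CuspForm (Gamma1 N) (K : ℤ) :=
    { toFun := F
      slash_action_eq' := fun A hA ↦ by
        obtain ⟨γ, hγ, rfl⟩ := hA
        exact hFslash γ hγ
      holo' := hFmd
      zero_at_cusps' := fun {c} hc ↦ by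
        rw [Subgroup.IsArithmetic.isCusp_iff_isCusp_SL2Z] at hc
        rw [OnePoint.isZeroAt_iff_forall_SL2Z hc]
        intro g _
        exact hFzero g }
  let G₁ : CuspForm (Gamma1 N) (K : ℤ) :=
    { toFun := Gt
      slash_action_eq' := fun A hA ↦ by
        obtain ⟨γ, hγ, rfl⟩ := hA
        exact hGslash γ hγ
      holo' := hGtmd
      zero_at_cusps' := fun {c} hc ↦ by
        rw [Subgroup.IsArithmetic.isCusp_iff_isCusp_SL2Z] at hc
        rw [OnePoint.isZeroAt_iff_forall_SL2Z hc]
        intro g _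
        exact hGzero g }
  have hK1 : (1 : ℤ) ≤ K := by omega
  refine ⟨(K : ℤ), F₁, G₁, hK1, ?_, fun τ hτ ↦ ?_⟩
  · -- `G₁ ≠ 0`: `G ≠ 0` and `Δ` has no zeros
    obtain ⟨τ₁, hτ₁⟩ := DFunLike.ne_iff.mp hX.1
    have hG1 : G τ₁ ≠ 0 := by simpa using hτ₁
    have hGt1 : Gt τ₁ ≠ 0 :=
      mul_ne_zero (mul_ne_zero (by norm_num) hG1) (pow_ne_zero _ (ModularForm.discriminant_ne_zero τ₁))
    intro h0
    apply hGt1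
    have h1 := DFunLike.congr_fun h0 τ₁
    exact h1
  · show ℘[L] (eichlerIntegral f τ) * Gt τ = F τ
    rw [← hFeq τ hτ, hGt]
    ring

/-! ### The Stevens lattice `Λ₁(f)` as a period pair -/

/-- **A period pair for `Λ₁(f)`.**  If `Λ₀(f) = periodLattice f` is the lattice of a period pair `L₀`, then `Λ₁(f) = periodLatticeGamma1 f`
is the lattice of a period pair `L₁` (`φ(N)·Λ₀ ⊆ Λ₁ ⊆ Λ₀`: `totient_mul_mem_periodLatticeGamma1`, `periodLatticeGamma1_le_periodLattice`;
`PeriodPair.exists_lattice_eq_of_le`). [cite: Stevens1989, §2] [cite: LingOesterle1991, Thm. 1] -/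
theorem exists_periodPair_periodLatticeGamma1 (f : CuspForm (Gamma0 N) 2) (L₀ : PeriodPair)
    (hL₀ : ∀ x, x ∈ L₀.lattice ↔ x ∈ periodLattice f) :
    ∃ L₁ : PeriodPair, ∀ x, x ∈ L₁.lattice ↔ x ∈ periodLatticeGamma1 f := by
  have hn0 : ((Nat.totient N : ℕ) : ℂ) ≠ 0 := by exact_mod_cast (Nat.totient_pos.mpr (NeZero.pos N)).ne'
  set P : PeriodPair := L₀.mulLeft ((Nat.totient N : ℕ) : ℂ) hn0 with hP
  have hle : P.lattice ≤ (periodLatticeGamma1 f).toIntSubmodule := by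
    intro z hz
    rw [hP, PeriodPair.mem_mulLeft_lattice] at hz
    have h1 := totient_mul_mem_periodLatticeGamma1 f ((hL₀ _).mp hz)
    rw [← mul_assoc, mul_inv_cancel₀ hn0, one_mul] at h1
    exact h1
  have hc' : ∀ z ∈ (periodLatticeGamma1 f).toIntSubmodule, ((Nat.totient N : ℕ) : ℂ) * z ∈ P.lattice := by
    intro z hz
    rw [hP, PeriodPair.mul_mem_mulLeft_lattice]
    exact (hL₀ z).mpr (periodLatticeGamma1_le_periodLattice f hz)
  obtain ⟨L₁, hL₁⟩ := P.exists_lattice_eq_of_le hle hn0 hc'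
  refine ⟨L₁, fun x ↦ ?_⟩
  show x ∈ L₁.lattice ↔ x ∈ (periodLatticeGamma1 f).toIntSubmodule
  rw [hL₁]

/-- **The `Γ₁(N)`-presentation for the Stevens lattice.**  For `f ≠ 0` and `Λ₁(f) = Λ(L₁)`: `℘_{Λ₁}(ℰ_f)·G₁ = F₁` off the
poles for some `F₁, G₁ ∈ S_k(Γ₁(N))`, `k ≥ 1`, `G₁ ≠ 0` (`exists_gamma1_presentation` with `L′ = φ(N)⁻¹·L₁ ⊇ Λ₀(f)`) — hypothesis `hpres` of
`StevensCurve.ratCast_g₂_g₃_of_gamma1_presentation`. [cite: ShimuraIATAF1971, Thm. 7.14] [cite: Stevens1989, §2] -/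
theorem exists_gamma1_presentation_periodLatticeGamma1 (f : CuspForm (Gamma0 N) 2) (hf : f ≠ 0) (L₁ : PeriodPair)
    (hL₁ : ∀ x, x ∈ L₁.lattice ↔ x ∈ periodLatticeGamma1 f) :
    ∃ (k : ℤ) (F G : CuspForm (Gamma1 N) k), 1 ≤ k ∧ G ≠ 0 ∧
      ∀ τ : ℍ, eichlerIntegral f τ ∉ L₁.lattice → ℘[L₁] (eichlerIntegral f τ) * G τ = F τ := by
  have hn0 : ((Nat.totient N : ℕ) : ℂ) ≠ 0 := by exact_mod_cast (Nat.totient_pos.mpr (NeZero.pos N)).ne'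
  set L' : PeriodPair := L₁.mulLeft (((Nat.totient N : ℕ) : ℂ)⁻¹) (inv_ne_zero hn0) with hL'
  refine exists_gamma1_presentation f hf L₁ L' (fun z hz ↦ ?_) (fun x hx ↦ ?_) (fun γ ↦ ?_)
  · rw [hL', PeriodPair.mem_mulLeft_lattice, inv_inv]
    have h1 := nsmul_mem ((hL₁ z).mp hz) (Nat.totient N)
    rw [nsmul_eq_mul] at h1
    exact (hL₁ _).mpr h1
  · rw [hL', PeriodPair.mem_mulLeft_lattice, inv_inv]
    exact (hL₁ _).mpr (totient_mul_mem_periodLatticeGamma1 f hx)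
  · exact (hL₁ _).mpr (cuspSymbol_mem_periodLatticeGamma1 f γ)

end Summit.BirchSwinnertonDyer.BirchSwinnertonDyer.Theorems.ManinLocalTwoThree.StevensCurve

end
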